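import Summits.QuantumFields.YangMills.Theorems.BalabanStepParabolic.Negative.OrbitTransport
import Summits.QuantumFields.YangMills.Theorems.ParabolicTrajectoryBalabanStepParabolicOrbitPrecompact
import HarnessLib

/-!
# Crux `BalabanStepParabolic` — forced accumulation of Wilson orbits: every tuning has a convergent sub-tuning

Support file for crux `stmt-QuantumFields-9684`
(`Summit.QuantumFields.YangMills.Theses.ParabolicTrajectory.BalabanStepParabolic`), line
`perfect-action-regulator-chart` (lead `prover-line-stmt-QuantumFields-9684-0`). Companion of
`…OrbitPrecompact` (precompactness of arrival states of long in-chart orbits, ANY inhabitant, any chart `E`) and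
of the disprover's `Negative/OrbitTransport.lean` (odd `M`: in-chart orbit points of Wilson points carry genuine
block-dilated Wilson data; a CONVERGENT sequence of such points forces convergence of those data).

`exists_subseq_tendsto_wilson`: for ANY inhabitant `S : BalabanBanachStep G r M` with `M` odd there is a threshold
`τ > 0` (`exists_threshold`) such that for EVERY sequence of Wilson couplings `g i ∈ (0, min τ g₀]` and block
depths `k i → ∞` with `2 c₁ k i ≤ 1/g i² − 1/τ²` (the in-chart range of `OrbitTransport.orbit_mem_chart`), a
subsequence `ψ` and a chart point `q` exist along which the orbit points `F^[k (ψ i)] (g (ψ i), yW (g (ψ i)))`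
converge to `q` and, consequently, for every odd torus `2L+1`, every `n` and every off-diagonal tuple `f`, the
genuine centred Wilson `n`-point functions at inverse coupling `betaOf (g (ψ i))` on the torus
`M^{k (ψ i)} (2L+1)` with `k (ψ i)`-fold block-dilated test functions converge (to `S.expect q (2L+1) n σ f`).
`exists_subseq_tendsto_wilson_of_tendsto_zero`: the same for every sequence of bare couplings `g i → 0⁺`, with the
maximal admissible depth `k i = ⌊(1/g i² − 1/τ²)/(2c₁)⌋`.

So the accumulation at which the continuity field (4c) bites is FORCED for every inhabitant — finite- or
infinite-dimensional chart, physical or over- or under-tuned slope `κ b₀` (`Negative/RescaleCoupling.lean`): to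
inhabit the structure one must control a joint continuum/thermodynamic limit of genuine 4-d Wilson plaquette
correlators along SOME sub-tuning of every tuning. This is the RG-free content that makes the line's load-bearing
stub (`∀ G r, ∃ M₀, ∀ M ≥ M₀, Odd M → Nonempty (RegulatorChart G r M)`, which inhabits the structure by
`regulatorChart_bridge`) crux-sized.
-/

open scoped SchwartzMap
open MeasureTheory Filter Topology
open Literature.MathematicalPhysics.AQFT Literature.MathematicalPhysics.QuantumLattice
open Literature.Probability.LatticeModels
open Literature.MathematicalPhysics.QuantumFieldTheory

noncomputable section

namespace Summit.QuantumFields.YangMills.Theorems.BalabanStepParabolic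

variable {G : Type} [Group G] [TopologicalSpace G] [IsTopologicalGroup G] [CompactSpace G]
  [MeasurableSpace G] [BorelSpace G] {r : LatticeRep G} {M : ℕ} (S : BalabanBanachStep G r M)

/-- **A threshold below the disprover's `gₛ` at which the chart ball is forward-invariant**: `0 < τ ≤ gₛ` and
`C τ² ≤ (1 − θ') δ / 2`. [folklore] -/
theorem exists_threshold : ∃ τ : ℝ, 0 < τ ∧
    τ ≤ min S.δ (min (Real.sqrt (1 / (2 * (S.b + S.C * (S.δ + S.R)))))
      (Real.sqrt ((1 - S.θ') * S.R / S.C))) ∧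
    S.C * τ ^ 2 ≤ (1 - S.θ') * (S.δ / 2) := by
  have hC := S.C_pos
  have hδ := S.δ_pos
  have h1θ : 0 < 1 - S.θ' := by linarith [S.θ'_lt_one]
  have hgs := Negative.gₛ_pos S
  refine ⟨min (min S.δ (min (Real.sqrt (1 / (2 * (S.b + S.C * (S.δ + S.R)))))
      (Real.sqrt ((1 - S.θ') * S.R / S.C)))) (Real.sqrt ((1 - S.θ') * (S.δ / 2) / S.C)),
    lt_min hgs (Real.sqrt_pos.2 (by positivity)), min_le_left _ _, ?_⟩
  have hle : min (min S.δ (min (Real.sqrt (1 / (2 * (S.b + S.C * (S.δ + S.R)))))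
      (Real.sqrt ((1 - S.θ') * S.R / S.C)))) (Real.sqrt ((1 - S.θ') * (S.δ / 2) / S.C)) ≤
      Real.sqrt ((1 - S.θ') * (S.δ / 2) / S.C) := min_le_right _ _
  have h0 : 0 ≤ min (min S.δ (min (Real.sqrt (1 / (2 * (S.b + S.C * (S.δ + S.R)))))
      (Real.sqrt ((1 - S.θ') * S.R / S.C)))) (Real.sqrt ((1 - S.θ') * (S.δ / 2) / S.C)) :=
    (lt_min hgs (Real.sqrt_pos.2 (by positivity))).le
  calc S.C * (min (min S.δ (min (Real.sqrt (1 / (2 * (S.b + S.C * (S.δ + S.R)))))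
        (Real.sqrt ((1 - S.θ') * S.R / S.C)))) (Real.sqrt ((1 - S.θ') * (S.δ / 2) / S.C))) ^ 2
      ≤ S.C * (Real.sqrt ((1 - S.θ') * (S.δ / 2) / S.C)) ^ 2 := by gcongr
    _ = S.C * ((1 - S.θ') * (S.δ / 2) / S.C) := by rw [Real.sq_sqrt (by positivity)]
    _ = (1 - S.θ') * (S.δ / 2) := by field_simp

/-- **Forced accumulation of Wilson orbits, with its consequence (odd `M`).** For a threshold `τ` as in
`exists_threshold`, EVERY tuning — Wilson couplings `g i ∈ (0, τ] ∩ (0, g₀]`, depths `k i → ∞` inside the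
in-chart range `2 c₁ k i ≤ 1/g i² − 1/τ²` — has a sub-tuning `ψ` along which the orbit points converge in the
chart and hence (disprover's `tendsto_wilson_of_tendsto_orbit`) the genuine centred Wilson `n`-point functions at
`β = betaOf (g (ψ i))` on the tori `M^{k (ψ i)}(2L+1)` with `k (ψ i)`-fold block-dilated off-diagonal test
functions converge, for all `L`, `n`, `σ`, `f` simultaneously. [folklore] -/
theorem exists_subseq_tendsto_wilson (hM : Odd M) {τ : ℝ} (hτ0 : 0 < τ)
    (hτs : τ ≤ min S.δ (min (Real.sqrt (1 / (2 * (S.b + S.C * (S.δ + S.R)))))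
      (Real.sqrt ((1 - S.θ') * S.R / S.C))))
    (hτδ : S.C * τ ^ 2 ≤ (1 - S.θ') * (S.δ / 2))
    (g : ℕ → ℝ) (k : ℕ → ℕ) (hg : ∀ i, 0 < g i ∧ g i ≤ τ ∧ g i ≤ S.g₀)
    (hkτ : ∀ i, 2 * (S.b + S.C * (S.δ + S.R)) * k i ≤ 1 / g i ^ 2 - 1 / τ ^ 2)
    (hk : Tendsto k atTop atTop) :
    ∃ ψ : ℕ → ℕ, StrictMono ψ ∧ ∃ q ∈ Set.Icc 0 S.δ ×ˢ Metric.closedBall (0 : S.E) S.R,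
      Tendsto (fun i => S.F^[k (ψ i)] (g (ψ i), S.yW (g (ψ i)))) atTop (𝓝 q) ∧
      ∀ (L n : ℕ) (σ : Fin n → YMSpecies G) (f : Fin n → 𝓢(EuclideanSpace ℝ (Fin 4), ℝ)),
        IsOffDiagonal (SchwartzMap.tensorFin n fun i => ofRealTest (f i)) →
        Tendsto (fun i => wilsonCentredSchwinger r.ρ (S.betaOf (g (ψ i)))
            ((M ^ (k (ψ i)) * (2 * L + 1) - 1) / 2) (S.c (g (ψ i))) n σ
            (fun j => (blockDilate M)^[k (ψ i)] (f j))) atTop (𝓝 (S.expect q (2 * L + 1) n σ f)) := by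
  have hgs := Negative.gₛ_pos S
  have hτδ' : τ ≤ S.δ := hτs.trans (Negative.gₛ_le_δ S)
  -- the disprover's in-chart range contains ours
  have hk' : ∀ i, 2 * (S.b + S.C * (S.δ + S.R)) * k i ≤ 1 / g i ^ 2 -
      1 / (min S.δ (min (Real.sqrt (1 / (2 * (S.b + S.C * (S.δ + S.R)))))
        (Real.sqrt ((1 - S.θ') * S.R / S.C)))) ^ 2 := by
    intro i
    have h : 1 / (min S.δ (min (Real.sqrt (1 / (2 * (S.b + S.C * (S.δ + S.R)))))
        (Real.sqrt ((1 - S.θ') * S.R / S.C)))) ^ 2 ≤ 1 / τ ^ 2 :=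
      one_div_le_one_div_of_le (by positivity) (pow_le_pow_left₀ hτ0.le hτs 2)
    linarith [hkτ i]
  -- couplings stay in `[0, τ]`, fibres in the basin
  have horb : ∀ i, ∀ j ≤ k i, (S.F^[j] (g i, S.yW (g i))).1 ∈ Set.Icc 0 τ := by
    intro i j hj
    obtain ⟨h1, -, -, h4⟩ := Negative.orbit_mem_chart S (hg i).1 ((hg i).2.1.trans hτs) (hg i).2.2
      (k i) (hk' i) j hj
    refine ⟨h1.le, ?_⟩
    have hj' : (2 * (S.b + S.C * (S.δ + S.R))) * (j : ℝ) ≤ 2 * (S.b + S.C * (S.δ + S.R)) * k i :=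
      mul_le_mul_of_nonneg_left (Nat.cast_le.2 hj) (by linarith [Negative.c₁_pos S])
    have h5 : 1 / τ ^ 2 ≤ 1 / (S.F^[j] (g i, S.yW (g i))).1 ^ 2 := by linarith [hkτ i]
    have h6 : (S.F^[j] (g i, S.yW (g i))).1 ^ 2 ≤ τ ^ 2 :=
      (one_div_le_one_div (by positivity) (by positivity)).1 h5
    exact (pow_le_pow_iff_left₀ h1.le hτ0.le two_ne_zero).1 h6
  have hq2 : ∀ i, ‖((g i, S.yW (g i)) : ℝ × S.E).2‖ ≤ S.R := fun i =>
    S.norm_yW_le (g i) ⟨(hg i).1.le, (hg i).2.2⟩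
  obtain ⟨ψ, hψ, p, hp, hlim⟩ :=
    exists_subseq_tendsto_orbit_of_basin S hτδ' hτδ (fun i => (g i, S.yW (g i))) k hq2 horb hk
  have hpchart : p ∈ Set.Icc 0 S.δ ×ˢ Metric.closedBall (0 : S.E) S.R := by
    refine Set.mk_mem_prod ⟨hp.1.1, hp.1.2.trans hτδ'⟩ ?_
    have h := hp.2
    rw [Metric.mem_closedBall] at h ⊢
    exact h.trans S.δ_le_R
  refine ⟨ψ, hψ, p, hpchart, hlim, fun L n σ f hf => ?_⟩
  have hgψ : ∀ j, g (ψ j) ∈ Set.Ioc 0 S.g₀ := fun j => ⟨(hg (ψ j)).1, (hg (ψ j)).2.2⟩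
  have hkψ : ∀ j, ∀ i ≤ k (ψ j), (S.F^[i] (g (ψ j), S.yW (g (ψ j)))).1 ∈ Set.Icc 0 S.δ ∧
      ‖(S.F^[i] (g (ψ j), S.yW (g (ψ j)))).2‖ ≤ S.R := fun j =>
    Negative.orbit_hyp S (hg (ψ j)).1 ((hg (ψ j)).2.1.trans hτs) (hg (ψ j)).2.2 (k (ψ j)) (hk' (ψ j))
  exact Negative.tendsto_wilson_of_tendsto_orbit S hM hgψ hkψ hpchart hlim L n σ f hf

/-- **Every sequence of bare couplings `g i → 0⁺` has a convergent sub-tuning at maximal admissible depth.** With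
`k i = ⌊(1/g i² − 1/τ²)/(2c₁)⌋` (so `k i → ∞`), the conclusion of `exists_subseq_tendsto_wilson` holds. [folklore] -/
theorem exists_subseq_tendsto_wilson_of_tendsto_zero (hM : Odd M) {τ : ℝ} (hτ0 : 0 < τ)
    (hτs : τ ≤ min S.δ (min (Real.sqrt (1 / (2 * (S.b + S.C * (S.δ + S.R)))))
      (Real.sqrt ((1 - S.θ') * S.R / S.C))))
    (hτδ : S.C * τ ^ 2 ≤ (1 - S.θ') * (S.δ / 2))
    (g : ℕ → ℝ) (hg : ∀ i, 0 < g i ∧ g i ≤ τ ∧ g i ≤ S.g₀) (hg0 : Tendsto g atTop (𝓝 0)) :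
    ∃ ψ : ℕ → ℕ, StrictMono ψ ∧ ∃ q ∈ Set.Icc 0 S.δ ×ˢ Metric.closedBall (0 : S.E) S.R,
      Tendsto (fun i => S.F^[⌊(1 / g (ψ i) ^ 2 - 1 / τ ^ 2) / (2 * (S.b + S.C * (S.δ + S.R)))⌋₊]
        (g (ψ i), S.yW (g (ψ i)))) atTop (𝓝 q) ∧
      ∀ (L n : ℕ) (σ : Fin n → YMSpecies G) (f : Fin n → 𝓢(EuclideanSpace ℝ (Fin 4), ℝ)),
        IsOffDiagonal (SchwartzMap.tensorFin n fun i => ofRealTest (f i)) →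
        Tendsto (fun i => wilsonCentredSchwinger r.ρ (S.betaOf (g (ψ i)))
            ((M ^ ⌊(1 / g (ψ i) ^ 2 - 1 / τ ^ 2) / (2 * (S.b + S.C * (S.δ + S.R)))⌋₊ * (2 * L + 1) - 1) / 2)
            (S.c (g (ψ i))) n σ
            (fun j => (blockDilate M)^[⌊(1 / g (ψ i) ^ 2 - 1 / τ ^ 2) /
              (2 * (S.b + S.C * (S.δ + S.R)))⌋₊] (f j))) atTop (𝓝 (S.expect q (2 * L + 1) n σ f)) := by
  have hc₁ := Negative.c₁_pos S
  set k : ℕ → ℕ := fun i => ⌊(1 / g i ^ 2 - 1 / τ ^ 2) / (2 * (S.b + S.C * (S.δ + S.R)))⌋₊ with hkdef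
  have hkτ : ∀ i, 2 * (S.b + S.C * (S.δ + S.R)) * k i ≤ 1 / g i ^ 2 - 1 / τ ^ 2 := by
    intro i
    have hnn : 0 ≤ (1 / g i ^ 2 - 1 / τ ^ 2) / (2 * (S.b + S.C * (S.δ + S.R))) := by
      have h : 1 / τ ^ 2 ≤ 1 / g i ^ 2 :=
        one_div_le_one_div_of_le (by have := (hg i).1; positivity)
          (pow_le_pow_left₀ (hg i).1.le (hg i).2.1 2)
      exact div_nonneg (by linarith) (by positivity)
    have hfl := Nat.floor_le hnn
    rw [le_div_iff₀ (by positivity)] at hfl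
    simp only [hkdef]
    linarith
  have hk : Tendsto k atTop atTop := by
    simp only [hkdef]
    refine tendsto_nat_floor_atTop.comp ?_
    refine Tendsto.atTop_div_const (by positivity) ?_
    refine tendsto_atTop_add_const_right _ (-(1 / τ ^ 2)) ?_
    have h1 : Tendsto (fun i => g i ^ 2) atTop (𝓝[>] 0) := by
      refine tendsto_nhdsWithin_iff.2 ⟨?_, Eventually.of_forall fun i => ?_⟩
      · simpa using hg0.pow 2
      · exact pow_pos (hg i).1 2
    have h2 := tendsto_inv_nhdsGT_zero.comp h1
    refine h2.congr fun i => ?_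
    simp [one_div]
  exact exists_subseq_tendsto_wilson S hM hτ0 hτs hτδ g k hg hkτ hk

/-- **Forced accumulation of Wilson orbits** (registered sub-goal `wilson_accumulation` of the crux item; all
binders explicit, no scoped notation): see `exists_subseq_tendsto_wilson`. [folklore] -/
theorem wilson_accumulation :
    ∀ (G : Type) [Group G] [TopologicalSpace G] [IsTopologicalGroup G] [CompactSpace G]
      [MeasurableSpace G] [BorelSpace G]
      (r : Literature.MathematicalPhysics.QuantumFieldTheory.LatticeRep G) (M : ℕ)
      (S : Literature.MathematicalPhysics.QuantumFieldTheory.BalabanBanachStep G r M),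
      Odd M → ∀ (τ : ℝ), 0 < τ →
      τ ≤ min S.δ (min (Real.sqrt (1 / (2 * (S.b + S.C * (S.δ + S.R)))))
        (Real.sqrt ((1 - S.θ') * S.R / S.C))) →
      S.C * τ ^ 2 ≤ (1 - S.θ') * (S.δ / 2) →
      ∀ (g : ℕ → ℝ) (k : ℕ → ℕ), (∀ i, 0 < g i ∧ g i ≤ τ ∧ g i ≤ S.g₀) →
        (∀ i, 2 * (S.b + S.C * (S.δ + S.R)) * k i ≤ 1 / g i ^ 2 - 1 / τ ^ 2) →
        Filter.Tendsto k Filter.atTop Filter.atTop →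
        ∃ ψ : ℕ → ℕ, StrictMono ψ ∧ ∃ q ∈ Set.Icc 0 S.δ ×ˢ Metric.closedBall (0 : S.E) S.R,
          Filter.Tendsto (fun i => S.F^[k (ψ i)] (g (ψ i), S.yW (g (ψ i)))) Filter.atTop (nhds q) ∧
          ∀ (L n : ℕ) (σ : Fin n → Literature.MathematicalPhysics.QuantumFieldTheory.YMSpecies G)
            (f : Fin n → SchwartzMap (EuclideanSpace ℝ (Fin 4)) ℝ),
            Literature.MathematicalPhysics.AQFT.IsOffDiagonal
              (SchwartzMap.tensorFin n fun i => Literature.MathematicalPhysics.QuantumLattice.ofRealTest (f i)) →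
            Filter.Tendsto (fun i =>
              Literature.MathematicalPhysics.QuantumFieldTheory.wilsonCentredSchwinger r.ρ (S.betaOf (g (ψ i)))
                ((M ^ (k (ψ i)) * (2 * L + 1) - 1) / 2) (S.c (g (ψ i))) n σ
                (fun j => (Literature.MathematicalPhysics.QuantumFieldTheory.blockDilate M)^[k (ψ i)] (f j)))
              Filter.atTop (nhds (S.expect q (2 * L + 1) n σ f)) :=
  fun _G _ _ _ _ _ _ _r _M S hM _τ hτ0 hτs hτδ g k hg hkτ hk =>
    exists_subseq_tendsto_wilson S hM hτ0 hτs hτδ g k hg hkτ hk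

end Summit.QuantumFields.YangMills.Theorems.BalabanStepParabolic

end
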